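import Summits.Langlands.Langlands.Theses.IrreducibilityBySelfDuality
import Literature.NumberTheory.GaloisRepresentations.HeckeCharacterArchType

/-!
# Sketch (crux-ideate round 1, ideator 3) — crux `RegularAdjointLiftCM` (stmt-Langlands-13617)

First lemmas of the two crux idea cards, stated over existing declarations (no proofs required at
this stage; every constant `lean search`ed):

* card `centre-vs-sl2-parity`:
  - `isRegularAlgebraic_of_centre_parity` — the reduction "2a = Σ + k": a GL₂ datum whose
    Harish-Chandra multiset at `ι` is `{a ι, a ι - k ι}` with `a ι ∈ ½ + ℤ`, `k ι ∈ ℤ ∖ {0}` is regular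
    algebraic (pure bookkeeping on `InfinityType`; provable now);
  - `ParityTwistGL1` — the TRANSFER C⁺ (a pure GL(1) statement over a CM field): given a cuspidal
    GL(1) datum `ω` (the central character of the descent `σ₀`) with HC parameters `Σ ι` and a parity
    pattern `ε`, locally consistent and of constant total parity, there is a GL(1) datum `χ` with
    HC parameters `s ι` such that `Σ ι + 2 s ι` is an integer of parity `ε ι` (so `ω χ²` is a
    weight-zero-type algebraic character of the prescribed parity).
* card `kronecker-real-congruence-units`:
  - `realUnits_of_sub_one_dvd` — congruence units of a CM field are real: `u ≡ 1 (mod m)`,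
    `m ≥ 3` ⇒ `u ∈ realUnits K` (Kronecker: `u/ū` is torsion — Mathlib `unitsMulComplexConjInv`).
* shared stubs both cards lean on, typed: `AdjointArchIdentity` (Gelbart–Jacquet at ∞ + SMO∞ at the
  level of Harish-Chandra multisets) and `CentralCharacterArch` (the central character of a cuspidal
  GL_n datum as a GL(1) datum whose HC parameter is the SUM).
-/

set_option linter.dupNamespace false

namespace Summit.Langlands.Langlands.Cruxes.RegularAdjointLiftCM.SketchIdeator3

open scoped BigOperators Classical
open Filter NumberField
open Literature.NumberTheory.Automorphic

/-! ## Card 1 — `centre-vs-sl2-parity` -/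

/-- "2a = Σ + k": regular algebraicity of a GL₂ datum read off its Harish-Chandra multisets alone.
If at every embedding `ι` the HC multiset of `σ` is `{a ι, a ι - k ι}` with `a ι ∈ ½ + ℤ` and
`k ι` a NON-ZERO integer, then `σ` is regular algebraic (the well-formed infinity type is
`ι ↦ {(a ι, a ῑ), (a ι - k ι, a ῑ - k ῑ)}`; C-algebraic for `n = 2` means exponents in `½ + ℤ`).
Provable now (bookkeeping on `InfinityType.IsWellFormed / IsCAlgebraic / IsRegular`). -/
theorem isRegularAlgebraic_of_centre_parity {K : Type} [Field K] [NumberField K]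
    {hcpt₂ : isCompact_glFiniteIntegralLevel 2 K}
    (σ : CuspidalAutomorphicRepData 2 K hcpt₂) (a : (K →+* ℂ) → ℂ) (k : (K →+* ℂ) → ℤ)
    (hA : σ.1.HasArchParameter fun ι => {a ι, a ι - k ι})
    (ha : ∀ ι, ∃ n : ℤ, a ι = n + 1 / 2) (hk : ∀ ι, k ι ≠ 0) :
    σ.1.IsRegularAlgebraic := by
  sorry

/-- TRANSFER C⁺ (`ParityTwistGL1`), the GL(1) statement the crux reduces to under "2a = Σ + k".
`K` CM; `ω` a cuspidal GL(1) datum (it will be the central character of Ramakrishnan's descent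
`σ₀`) with Harish-Chandra parameter `ι ↦ {Σ ι}`; `ε` a parity pattern on the embeddings such that
(local consistency) `Σ ι - Σ ῑ ≡ ε ι - ε ῑ (mod 2)` — in particular the angular integers of `ω` are
integers of the parity of `ε ι - ε ῑ` — and (global) `ε ι + ε ῑ` has the same parity at every
complex place. THEN some cuspidal GL(1) datum `χ` has Harish-Chandra parameter `ι ↦ {s ι}` with
`Σ ι + 2 s ι` an integer of parity `ε ι` (i.e. `ω χ²` is algebraic of weight-zero type, parity `ε`).
Over CM this holds by: weight-zero algebraic characters of every type exist (Kronecker: congruence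
units are real) + Weil's unit criterion on squares of congruence units (Chevalley). False with
`IsCMField` dropped (totally real `K`: `ε` must be parallel). -/
def ParityTwistGL1 : Prop :=
  ∀ (K : Type) [Field K] [NumberField K], IsCMField K →
    ∀ (h1 : isCompact_glFiniteIntegralLevel 1 K) (ω : CuspidalAutomorphicRepData 1 K h1)
      (Sg : (K →+* ℂ) → ℂ), ω.1.HasArchParameter (fun ι => {Sg ι}) →
    ∀ (ε : (K →+* ℂ) → ℤ),
      (∀ ι, ∃ n : ℤ, Sg ι - Sg (ComplexEmbedding.conjugate ι)
          = (ε ι - ε (ComplexEmbedding.conjugate ι) : ℤ) + 2 * n) →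
      (∃ c : ℤ, ∀ ι, ∃ n : ℤ, ε ι + ε (ComplexEmbedding.conjugate ι) = c + 2 * n) →
      ∃ (χ : CuspidalAutomorphicRepData 1 K h1) (s : (K →+* ℂ) → ℂ),
        χ.1.HasArchParameter (fun ι => {s ι}) ∧
        ∀ ι, ∃ m : ℤ, Sg ι + 2 * s ι = m ∧ ∃ n : ℤ, m = ε ι + 2 * n

/-- The transfer elaborates as a proposition; the line proves the crux from it, `AdjointArchIdentity`,
Clozel purity of `Π` (multiset form, `Clozel1990_regularAlgebraic.purity`), `CentralCharacterArch`,
the Hecke twist with its HC shift, and `isRegularAlgebraic_of_centre_parity`. -/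
theorem parityTwistGL1_stub : ParityTwistGL1 := by
  sorry

/-! ## Card 2 — `kronecker-real-congruence-units` -/

/-- KRONECKER MAKES THE CM STEP FREE: in a CM field, a unit congruent to `1` modulo a rational
integer `m ≥ 3` is REAL (lies in `realUnits K`, the units coming from `K⁺`). Proof: `ū ≡ 1 (mod m)`
too, so `u ū⁻¹ ≡ 1 (mod m)`; `u ū⁻¹` is a root of unity (Mathlib: `unitsMulComplexConjInv K u ∈
torsion K`, i.e. Kronecker's theorem is already in the definition), and a root of unity `≡ 1 (mod m)`,
`m ≥ 3`, is `1` (norm bound `∏ |ζ^σ - 1| ≤ 2^d < m^d`); hence `u = ū`, i.e.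
`u ∈ (unitsMulComplexConjInv K).ker = realUnits K`. Consequence for the crux: the archimedean type of
every character needed in the CM re-twisting step is trivial on ALL real units or on their squares,
so no unit-index theorem, no total positivity and no `K⁺` bookkeeping is needed — only congruence
subgroups `E_m`. Provable now (S–M). -/
theorem realUnits_of_sub_one_dvd (K : Type) [Field K] [NumberField K] [IsCMField K]
    (m : ℕ) (hm : 3 ≤ m) (u : (RingOfIntegers K)ˣ)
    (hu : (m : RingOfIntegers K) ∣ (u : RingOfIntegers K) - 1) :
    u ∈ IsCMField.realUnits K := by
  sorry

/-- The weight-zero corollary used by card 1's engine (typed as a target, NOT proved here): over a CM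
field, for every integer pattern `mι` anti-symmetric under conjugation (`m ῑ = - m ι`), there is a
cuspidal GL(1) datum with Harish-Chandra parameter `ι ↦ {m ι}` (an algebraic Hecke character of
weight-zero type `(m ι, -m ι)`): its archimedean type `∏ (z_w / z̄_w)^{m}` is trivial on every real
unit EXACTLY, so by `realUnits_of_sub_one_dvd` it kills the congruence subgroup `E_3` — no Chevalley. -/
def WeightZeroCharacterCM : Prop :=
  ∀ (K : Type) [Field K] [NumberField K], IsCMField K →
    ∀ (h1 : isCompact_glFiniteIntegralLevel 1 K) (m : (K →+* ℂ) → ℤ),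
      (∀ ι, m (ComplexEmbedding.conjugate ι) = - m ι) →
      ∃ μ : CuspidalAutomorphicRepData 1 K h1,
        μ.1.HasArchParameter (fun ι => {(m ι : ℂ)}) ∧ μ.1.IsRegularAlgebraic

/-- THE ONE REMAINING UNIT INPUT (card 2's reduction; field-independent): squares of a congruence
unit group contain a congruence unit group — the exponent-2 case of Chevalley 1951 Thm 1
(`Chevalley1951.thm1_units` ⇒ this, since `(E_𝔪)²` has finite index in `(𝓞 K)ˣ`); conversely this
is ALL the unit theory the CM re-twisting step consumes once `realUnits_of_sub_one_dvd` is known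
(the re-twisting character is `±1`-valued on `E_𝔪 ∩ realUnits`, `𝔪 = m · cond ω_{σ₀}`). Plausibly
provable from Kummer theory for square roots (Mathlib `KummerExtension`) + Chebotarev (proved in the
tree) — see the card for the sign-pattern caveat. -/
def SquaresOfCongruenceUnits : Prop :=
  ∀ (K : Type) [Field K] [NumberField K] (𝔪 : Ideal (RingOfIntegers K)), 𝔪 ≠ ⊥ →
    ∃ 𝔪' : Ideal (RingOfIntegers K), 𝔪' ≠ ⊥ ∧
      ∀ u : (RingOfIntegers K)ˣ, (u : RingOfIntegers K) - 1 ∈ 𝔪' →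
        ∃ x : (RingOfIntegers K)ˣ, (x : RingOfIntegers K) - 1 ∈ 𝔪 ∧ u = x ^ 2

/-- The extension step in GL(1)-datum language (Weil's criterion, existence direction, for types
trivial on a congruence unit group; typed over the tree's `HeckeCharacter.HasUnitaryArchType`):
a unitary archimedean type `(m_w, t_w)` whose unit product is trivial on the congruence group `E_𝔪`
IS the type of a Hecke character. With `realUnits_of_sub_one_dvd` + `SquaresOfCongruenceUnits` this
replaces the pair of vendored facts `Patrikis2019_heckeCharacter_archType_iff_units` /
`Chevalley1951.thm1_units` for every type met in this crux. -/
def ArchTypeOfCongruenceTrivial : Prop :=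
  ∀ (K : Type) [Field K] [NumberField K] (m : InfinitePlace K → ℤ) (t : InfinitePlace K → ℝ)
    (𝔪 : Ideal (RingOfIntegers K)), 𝔪 ≠ ⊥ →
    (∀ u : (RingOfIntegers K)ˣ, (u : RingOfIntegers K) - 1 ∈ 𝔪 →
      (∏ w : InfinitePlace K,
        (w.embedding ((u : RingOfIntegers K) : K) / (‖w.embedding ((u : RingOfIntegers K) : K)‖ : ℂ)) ^ (m w) *
          ((‖w.embedding ((u : RingOfIntegers K) : K)‖ : ℂ) ^ ((t w : ℂ) * Complex.I))) = 1) →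
    ∃ ψ : Literature.NumberTheory.GaloisRepresentations.HeckeCharacter K, ψ.HasUnitaryArchType m t

/-! ## Shared stubs (both cards lean on them; typed here so that crux-plan can register them) -/

/-- ADJ∞ — the archimedean adjoint identity at the level of Harish-Chandra multisets (Gelbart–Jacquet
1978 Thm (9.3) at ALL places + strong multiplicity one with archimedean components, JS 1981 II
Thm 4.4 — the latter is bookkeeping over the tree's L²-equality form `strong_multiplicity_one_gl`
and the BJ↔L² bridge facts): if `t_{Π,v} = d_v · Ad(t_{σ₀,v})` a.e. with `σ₀` non-dihedral, then
for HC parameters `{a₁ ι, a₂ ι}` of `σ₀` and `{c ι}` of `ν`, the HC parameter of `Π` at `ι` is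
`{a₁ ι - a₂ ι + c ι, c ι, a₂ ι - a₁ ι + c ι}`. -/
def AdjointArchIdentity : Prop :=
  ∀ (K : Type) [Field K] [NumberField K] (h1 : isCompact_glFiniteIntegralLevel 1 K)
    (h2 : isCompact_glFiniteIntegralLevel 2 K) (h3 : isCompact_glFiniteIntegralLevel 3 K)
    (P3 : CuspidalAutomorphicRepData 3 K h3) (σ₀ : CuspidalAutomorphicRepData 2 K h2)
    (ν : CuspidalAutomorphicRepData 1 K h1),
    (∀ (L : Type) [Field L] [NumberField L] [Algebra K L], Module.finrank K L = 2 →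
        ¬ (∀ᶠ v in cofinite, ∀ β : Multiset ℂ, σ₀.1.HasSatakeParamAt v β →
          β.map (fun b => (if ∃ w : IsDedekindDomain.HeightOneSpectrum (RingOfIntegers L),
              w.asIdeal.under (RingOfIntegers K) = v.asIdeal ∧
                w.asIdeal.inertiaDeg (RingOfIntegers K) = 1 then (1 : ℂ) else -1) * b) = β)) →
    (∀ᶠ v in cofinite, ∀ α β : Multiset ℂ, P3.1.HasSatakeParamAt v α → σ₀.1.HasSatakeParamAt v β →
        ∃ d : ℂ, ν.1.HasSatakeParamAt v {d} ∧
          α = (((β ×ˢ β).map (fun p : ℂ × ℂ => p.1 * p.2⁻¹)).erase 1).map (fun x => d * x)) →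
    ∃ (a₁ a₂ c : (K →+* ℂ) → ℂ),
      σ₀.1.HasArchParameter (fun ι => {a₁ ι, a₂ ι}) ∧ ν.1.HasArchParameter (fun ι => {c ι}) ∧
      P3.1.HasArchParameter (fun ι => {a₁ ι - a₂ ι + c ι, c ι, a₂ ι - a₁ ι + c ι})

/-- CC∞ — the central character of a cuspidal `GL_n` datum as a cuspidal GL(1) datum whose
Harish-Chandra parameter is the SUM of the HC multiset and whose Satake parameter is the PRODUCT
(finite part PROVED in the tree: `AutomorphicRepData.exists_centralCharacter`,
`CuspidalAutomorphicRepData.exists_heckeCharacter_prod_satake_bj` + the GL(1) dictionary; the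
archimedean clause is the new content: the central `x · 1_n ∈ 𝔤` acts by `∑ aᵢ`). -/
def CentralCharacterArch : Prop :=
  ∀ (n : ℕ) (K : Type) [Field K] [NumberField K] (hcpt : isCompact_glFiniteIntegralLevel n K)
    (h1 : isCompact_glFiniteIntegralLevel 1 K) (π : CuspidalAutomorphicRepData n K hcpt)
    (A : (K →+* ℂ) → Multiset ℂ), 0 < n → π.1.HasArchParameter A →
    ∃ ω : CuspidalAutomorphicRepData 1 K h1,
      ω.1.HasArchParameter (fun ι => {(A ι).sum}) ∧
      ∀ (v : IsDedekindDomain.HeightOneSpectrum (RingOfIntegers K)) (α : Multiset ℂ),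
        π.1.HasSatakeParamAt v α → ω.1.HasSatakeParamAt v {α.prod}

/-- Sanity: the crux decl is in scope and these sketches live next to it (no proof attempted). -/
example : Prop := Summit.Langlands.Langlands.Theses.IrreducibilityBySelfDuality.RegularAdjointLiftCM

end Summit.Langlands.Langlands.Cruxes.RegularAdjointLiftCM.SketchIdeator3
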